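import Literature.NumberTheory.Rogawski1990.AdelicStableOrbitalEulerDischarge
import Literature.NumberTheory.Rogawski1990.MatchingAdeleGKConjHolds
import Literature.NumberTheory.Automorphic.CompactCoreLevelConj
import Literature.NumberTheory.Automorphic.CompactCoreCentralizerLevelOfIntegralConjugacy
import HarnessLib

/-!
# The (xii-d) discharge for CANONICAL local families: all arithmetic hypotheses of ★ `MatchingAdeleG.exists_isEulerOnClasses_ofLocalAdelic` discharged
(Rogawski (1990), §4.3 pp. 43–44, §5.4 (5.4.3) pp. 72–73; Kottwitz (1986) Prop. 7.1)

Topic `NumberTheory/Rogawski1990`; namespace `Literature.NumberTheory.Rogawski1990`.  THEOREMS ONLY: no definition, no named fact, no instance, no `sorry`.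
Cell `pub/hodgecm-mathlib`, ENGINE T1, ED 1.19c (xii-d) ∕ O11.  ★ (E3c) proved `IsEulerOnClasses 𝒞_𝐀(γ₀) (ofLocalAdelic mq mqi) T.eval S …` under
the [Kt₄]-7.1 fact, two normalisation hypotheses on `mq`, admissibility, and integrability.  Here the first three are DISCHARGED for local families
`mq v` CANONICAL on the regular classes for Haar measures `ν_v` with `ν_v(U(Φ₃)(𝒪_v)) = 1` (the kit's `ComparisonKit.mq`, canonical by ★
`transport_isCanonical_isRegularElt`): the fact is ★ `MatchingAdeleGEventuallyKConj_holds` (F0P3a-p03), the normalisation at `toAdelic γ` is ★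
`UnitaryGroup.exists_isNormalisedOff_of_isCanonical` (F0P3a-p05) with ★ `compactCoreCentralizerLevelAE_of_hermitian` (F0P3a-p06) at `Φ₃`, the
normalisation at every matching adèle is ★ `UnitaryGroup.exists_isNormalisedOff_matchingAdeleG` (F0P3a-p01), admissibility is ★ `IsCanonical.isAdmissibleOn`.
What REMAINS as hypotheses: `mqi` admissible on the regular archimedean classes, and the integrability `hFi` of the orbital integrands at the adelic classes
(the closed-orbit input for the quasi-split group, not yet in the tree).
HC_CM is proved only modulo the printed citations until rung 0 closes.

## References
* [Rogawski1990] J. D. Rogawski, *Automorphic Representations of Unitary Groups in Three Variables*, Ann. of Math. Stud. 123 (1990), §4.3 pp. 43–44, §5.4 pp. 72–73.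
* [Kottwitz1986] R. E. Kottwitz, *Stable trace formula: elliptic singular terms*, Math. Ann. 275 (1986), Prop. 7.1.
-/

noncomputable section

open NumberField IsDedekindDomain Filter Function MeasureTheory
open scoped MatrixGroups

namespace Literature.NumberTheory.Rogawski1990

open Literature.NumberTheory.Automorphic Literature.MeasureTheory.Group

section Canonical

variable {L : Type} [Field L] [NumberField L] [IsCMField L] {H : Matrix (Fin 3) (Fin 3) L}
  {γ₀ : (UnitaryGroup.cmDatum L 3 H).Rational}
  {γ : (UnitaryGroup.cmDatum L 3 (Matrix.of fun i j : Fin 3 => if i.val + j.val + 1 = 3 then (1 : L) else 0)).Rational}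
  [∀ g : (UnitaryGroup.cmDatum L 3 (Matrix.of fun i j : Fin 3 => if i.val + j.val + 1 = 3 then (1 : L) else 0)).Adelic,
    MeasurableSpace ((UnitaryGroup.cmDatum L 3 (Matrix.of fun i j : Fin 3 => if i.val + j.val + 1 = 3 then (1 : L) else 0)).Adelic ⧸ Subgroup.centralizer ({g} : Set (UnitaryGroup.cmDatum L 3 (Matrix.of fun i j : Fin 3 => if i.val + j.val + 1 = 3 then (1 : L) else 0)).Adelic))]
  [∀ g : (UnitaryGroup.cmDatum L 3 (Matrix.of fun i j : Fin 3 => if i.val + j.val + 1 = 3 then (1 : L) else 0)).Adelic,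
    BorelSpace ((UnitaryGroup.cmDatum L 3 (Matrix.of fun i j : Fin 3 => if i.val + j.val + 1 = 3 then (1 : L) else 0)).Adelic ⧸ Subgroup.centralizer ({g} : Set (UnitaryGroup.cmDatum L 3 (Matrix.of fun i j : Fin 3 => if i.val + j.val + 1 = 3 then (1 : L) else 0)).Adelic))]
  [∀ (v : HeightOneSpectrum (𝓞 ↥(maximalRealSubfield L))) (x : (UnitaryGroup.cmDatum L 3 (Matrix.of fun i j : Fin 3 => if i.val + j.val + 1 = 3 then (1 : L) else 0)).Local v),
    MeasurableSpace ((UnitaryGroup.cmDatum L 3 (Matrix.of fun i j : Fin 3 => if i.val + j.val + 1 = 3 then (1 : L) else 0)).Local v ⧸ Subgroup.centralizer ({x} : Set ((UnitaryGroup.cmDatum L 3 (Matrix.of fun i j : Fin 3 => if i.val + j.val + 1 = 3 then (1 : L) else 0)).Local v)))]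
  [∀ (v : HeightOneSpectrum (𝓞 ↥(maximalRealSubfield L))) (x : (UnitaryGroup.cmDatum L 3 (Matrix.of fun i j : Fin 3 => if i.val + j.val + 1 = 3 then (1 : L) else 0)).Local v),
    BorelSpace ((UnitaryGroup.cmDatum L 3 (Matrix.of fun i j : Fin 3 => if i.val + j.val + 1 = 3 then (1 : L) else 0)).Local v ⧸ Subgroup.centralizer ({x} : Set ((UnitaryGroup.cmDatum L 3 (Matrix.of fun i j : Fin 3 => if i.val + j.val + 1 = 3 then (1 : L) else 0)).Local v)))]
  [∀ v : HeightOneSpectrum (𝓞 ↥(maximalRealSubfield L)), MeasurableSpace ((UnitaryGroup.cmDatum L 3 (Matrix.of fun i j : Fin 3 => if i.val + j.val + 1 = 3 then (1 : L) else 0)).Local v)]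
  [∀ v : HeightOneSpectrum (𝓞 ↥(maximalRealSubfield L)), BorelSpace ((UnitaryGroup.cmDatum L 3 (Matrix.of fun i j : Fin 3 => if i.val + j.val + 1 = 3 then (1 : L) else 0)).Local v)]
  [∀ a : UnitaryGroup.arch (↥(maximalRealSubfield L)) L (IsCMField.complexConj L) 3 (Matrix.of fun i j : Fin 3 => if i.val + j.val + 1 = 3 then (1 : L) else 0),
    MeasurableSpace (UnitaryGroup.arch (↥(maximalRealSubfield L)) L (IsCMField.complexConj L) 3 (Matrix.of fun i j : Fin 3 => if i.val + j.val + 1 = 3 then (1 : L) else 0) ⧸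
      Subgroup.centralizer ({a} : Set (UnitaryGroup.arch (↥(maximalRealSubfield L)) L (IsCMField.complexConj L) 3 (Matrix.of fun i j : Fin 3 => if i.val + j.val + 1 = 3 then (1 : L) else 0))))]
  [∀ a : UnitaryGroup.arch (↥(maximalRealSubfield L)) L (IsCMField.complexConj L) 3 (Matrix.of fun i j : Fin 3 => if i.val + j.val + 1 = 3 then (1 : L) else 0),
    BorelSpace (UnitaryGroup.arch (↥(maximalRealSubfield L)) L (IsCMField.complexConj L) 3 (Matrix.of fun i j : Fin 3 => if i.val + j.val + 1 = 3 then (1 : L) else 0) ⧸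
      Subgroup.centralizer ({a} : Set (UnitaryGroup.arch (↥(maximalRealSubfield L)) L (IsCMField.complexConj L) 3 (Matrix.of fun i j : Fin 3 => if i.val + j.val + 1 = 3 then (1 : L) else 0))))]

/-- **(xii-d) for CANONICAL `mq`**: `γ₀ ∈ U(H)(L⁺)` regular with rational correspondent `γ ∈ U(Φ₃)(L⁺)`; local families `mq v` CANONICAL on the regular classes
for Haar measures `ν_v` with `ν_v(U(Φ₃)(𝒪_v)) = 1`; `mqi` admissible on the regular classes; an `IsTest` pure tensor `T` with integrable orbital integrands at
the classes of `𝒞_𝐀(γ₀)`.  Then `∃ S₁, ∀ S ⊇ S₁, IsEulerOnClasses 𝒞_𝐀(γ₀) (ofLocalAdelic mq mqi) T.eval S (v ↦ Φ^st_v(γ_v)) (Φ^st_∞(γ ⊗ 1))` — ★ (E3c) with the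
[Kt₄] fact (★ `MatchingAdeleGEventuallyKConj_holds`) and both normalisations (★ `exists_isNormalisedOff_of_isCanonical`, ★ `exists_isNormalisedOff_matchingAdeleG`,
★ `compactCoreCentralizerLevelAE_of_hermitian` at `Φ₃`) DISCHARGED. [cite: Rogawski1990, §4.3 pp. 43–44; §5.4 (5.4.3) pp. 72–73] [cite: Kottwitz1986, Prop. 7.1] -/
theorem MatchingAdeleG.exists_isEulerOnClasses_ofLocalAdelic_of_isCanonical
    (hreg : IsRegularElt (γ₀.val : GL (Fin 3) L))
    (hγ : Corresponds (cmConjRingHom L) H (Matrix.of fun i j : Fin 3 => if i.val + j.val + 1 = 3 then (1 : L) else 0) γ₀ γ)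
    (ν : ∀ v : HeightOneSpectrum (𝓞 ↥(maximalRealSubfield L)), Measure ((UnitaryGroup.cmDatum L 3 (Matrix.of fun i j : Fin 3 => if i.val + j.val + 1 = 3 then (1 : L) else 0)).Local v))
    [∀ v, (ν v).IsHaarMeasure] [∀ v, (ν v).IsMulRightInvariant]
    (hν : ∀ v, ν v (UnitaryGroup.cmLocalIntegralLevel L 3 (Matrix.of fun i j : Fin 3 => if i.val + j.val + 1 = 3 then (1 : L) else 0) v) = 1)
    (mq : ∀ v : HeightOneSpectrum (𝓞 ↥(maximalRealSubfield L)), OrbitalMeasureFamily ((UnitaryGroup.cmDatum L 3 (Matrix.of fun i j : Fin 3 => if i.val + j.val + 1 = 3 then (1 : L) else 0)).Local v))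
    (hcan : ∀ v, (mq v).IsCanonical (fun x => IsRegularElt (x.val : GL (Fin 3) (UnitaryGroup.LocalRing L v))) (ν v))
    (mqi : OrbitalMeasureFamily (UnitaryGroup.arch (↥(maximalRealSubfield L)) L (IsCMField.complexConj L) 3 (Matrix.of fun i j : Fin 3 => if i.val + j.val + 1 = 3 then (1 : L) else 0)))
    (hadmA : mqi.IsAdmissibleOn fun a => IsRegularElt (a.val : GL (Fin 3) (mixedEmbedding.mixedSpace L)))
    (T : UnitaryGroup.PureTensor L 3 (Matrix.of fun i j : Fin 3 => if i.val + j.val + 1 = 3 then (1 : L) else 0)) (hT : T.IsTest)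
    (hFi : ∀ c ∈ MatchingAdeleG.classes L H γ₀, Integrable
      (descConj (Quotient.out c : (UnitaryGroup.cmDatum L 3 (Matrix.of fun i j : Fin 3 => if i.val + j.val + 1 = 3 then (1 : L) else 0)).Adelic)
        (Subgroup.centralizer ({(Quotient.out c : (UnitaryGroup.cmDatum L 3 (Matrix.of fun i j : Fin 3 => if i.val + j.val + 1 = 3 then (1 : L) else 0)).Adelic)} : Set (UnitaryGroup.cmDatum L 3 (Matrix.of fun i j : Fin 3 => if i.val + j.val + 1 = 3 then (1 : L) else 0)).Adelic))
        (centralizer_comm _) T.eval)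
      (UnitaryGroup.OrbitalMeasureFamily.ofLocalAdelic L 3 (Matrix.of fun i j : Fin 3 => if i.val + j.val + 1 = 3 then (1 : L) else 0) mq mqi c)) :
    ∃ S₁ : Finset (HeightOneSpectrum (𝓞 ↥(maximalRealSubfield L))), ∀ S : Finset (HeightOneSpectrum (𝓞 ↥(maximalRealSubfield L))), S₁ ⊆ S →
      IsEulerOnClasses (MatchingAdeleG.classes L H γ₀) (UnitaryGroup.OrbitalMeasureFamily.ofLocalAdelic L 3 (Matrix.of fun i j : Fin 3 => if i.val + j.val + 1 = 3 then (1 : L) else 0) mq mqi) T.eval S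
        (fun v => localStableOrbitalIntegral L 3 (Matrix.of fun i j : Fin 3 => if i.val + j.val + 1 = 3 then (1 : L) else 0) v (mq v) (T.loc v)
          ((UnitaryGroup.cmDatum L 3 (Matrix.of fun i j : Fin 3 => if i.val + j.val + 1 = 3 then (1 : L) else 0)).toLocal v ((UnitaryGroup.cmDatum L 3 (Matrix.of fun i j : Fin 3 => if i.val + j.val + 1 = 3 then (1 : L) else 0)).toAdelic γ)))
        (archStableOrbitalIntegral L 3 (Matrix.of fun i j : Fin 3 => if i.val + j.val + 1 = 3 then (1 : L) else 0) mqi T.arch (cmRationalToArch L 3 (Matrix.of fun i j : Fin 3 => if i.val + j.val + 1 = 3 then (1 : L) else 0) γ)) := by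
  have hγreg : IsRegularElt (γ.val : GL (Fin 3) L) := isRegularElt_of_isConj hγ hreg
  have hγv : ∀ v : HeightOneSpectrum (𝓞 ↥(maximalRealSubfield L)),
      IsRegularElt (((UnitaryGroup.cmDatum L 3 (Matrix.of fun i j : Fin 3 => if i.val + j.val + 1 = 3 then (1 : L) else 0)).toLocal v ((UnitaryGroup.cmDatum L 3 (Matrix.of fun i j : Fin 3 => if i.val + j.val + 1 = 3 then (1 : L) else 0)).toAdelic γ)).val :
        GL (Fin 3) (UnitaryGroup.LocalRing L v)) := fun v =>
    (hγreg.map (algebraMap L (AdeleRing (𝓞 L) L))).map (UnitaryGroup.adeleToLocal L v)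
  -- regularity of class representatives of regular points
  have hregout : ∀ v (x : (UnitaryGroup.cmDatum L 3 (Matrix.of fun i j : Fin 3 => if i.val + j.val + 1 = 3 then (1 : L) else 0)).Local v), IsRegularElt (x.val : GL (Fin 3) (UnitaryGroup.LocalRing L v)) →
      IsRegularElt ((Quotient.out (ConjClasses.mk x) : (UnitaryGroup.cmDatum L 3 (Matrix.of fun i j : Fin 3 => if i.val + j.val + 1 = 3 then (1 : L) else 0)).Local v).val : GL (Fin 3) (UnitaryGroup.LocalRing L v)) :=
    fun v x hx => isRegularElt_of_isConj ((UnitaryGroup.«local» L (IsCMField.complexConj L) 3 (Matrix.of fun i j : Fin 3 => if i.val + j.val + 1 = 3 then (1 : L) else 0) v).subtype.map_isConj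
      (isConj_out_conjClasses_mk x)) hx
  have hF : UnitaryGroup.CompactCoreCentralizerLevelAE L 3 (Matrix.of fun i j : Fin 3 => if i.val + j.val + 1 = 3 then (1 : L) else 0) :=
    UnitaryGroup.compactCoreCentralizerLevelAE_of_hermitian L 3 (Matrix.of fun i j : Fin 3 => if i.val + j.val + 1 = 3 then (1 : L) else 0) (UnitaryGroup.antidiagOne_isHermitian L 3)
      (UnitaryGroup.isUnit_antidiagOne_det L 3).ne_zero
  refine MatchingAdeleG.exists_isEulerOnClasses_ofLocalAdelic (MatchingAdeleGEventuallyKConj_holds L H) hreg hγ mq mqi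
    (fun v => (hcan v).isAdmissibleOn) hadmA ?_ (fun p => ?_) T hT hFi
  · -- normalisation at the rational base point (★ p05)
    exact UnitaryGroup.exists_isNormalisedOff_of_isCanonical L 3 (Matrix.of fun i j : Fin 3 => if i.val + j.val + 1 = 3 then (1 : L) else 0) _ ν hν mq hcan hF γ hγreg (fun v => hregout v _ (hγv v))
  · -- normalisation at every matching adèle (★ `CompactCoreLevelConj` §3)
    refine UnitaryGroup.exists_isNormalisedOff_matchingAdeleG L H _ ν hν mq hcan (MatchingAdeleGEventuallyKConj_holds L H) hF hreg hγ p
      fun v => hregout v _ ?_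
    exact isRegularElt_of_isConj ((corresponds_toLocal_toAdelic hγ v).isStablyConj_right (p.corresponds_toLocal v)) (hγv v)

end Canonical

end Literature.NumberTheory.Rogawski1990

end
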